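import HarnessLib
import Literature.Analysis.ValidatedNumerics.TrigLogTables
import Summits.RiemannHypothesis.RiemannHypothesis.Theorems.SignConePointwiseBounds

/-!
# Route SignCone: interval enclosures for the pointwise certificates (engine glue)

Support for the unconditional rungs of `SignConeOscillatory` / `SignConeInequality`
(items stmt-RiemannHypothesis-16302 / 16301). Kernel-evaluable enclosures, in the tree's verified
fixed-point interval engine (`Literature.Analysis.ValidatedNumerics`, `FI`/`CB`, scale `2^48`), of
the ingredients of the closed form `Ê_χ = ehatCF` of `SignConePointwiseTransform.lean` at a rational
point `u`:

* `PW.expFI q ∋ e^q` (`(e^{q/16})^{16}`), `PW.coshSinhFI q ∋ (cosh(q/2), sinh(q/2))`;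
* `PW.cbPow`, `PW.mem_knotTrig`: `e^{i x_k u} = e^{iLu} (e^{ihu})^k` for the knots `x_k = L + kh`
  (two calls of the engine's `e^{iθ}` per point instead of `K + 1`);
* `PW.TFI ∋ T(x_k, u)`, `PW.fiSumIco` (sums over `Finset.Ico 1 K`), `PW.ehatFI ∋ ehatCF d u`;
* `PW.combFI ∋ Σ_n a_n cos(u log n)` over a list of nodes (logarithms from `FI.logTable`).

Each definition comes with its inclusion theorem; nothing here is specific to one certificate.
-/

noncomputable section

-- `Summit.RiemannHypothesis.RiemannHypothesis.…` repeats a namespace component by design (D-0017 layout).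
set_option linter.dupNamespace false

open Real

namespace Summit.RiemannHypothesis.RiemannHypothesis.Theorems.SignCone

open Literature.Analysis.ValidatedNumerics.Numerics

namespace PW

/-! ## `exp`, `cosh`, `sinh` of rationals -/

/-- Enclosure of `e^q` for a rational `q` with `|q| ≤ 16` (`(e^{q/16})^{16}`; `none` if the engine
declines). [folklore] -/
def expFI (q : ℚ) : Option FI :=
  match FI.expSmall (FI.ofRat (q / 16)) with
  | some I => some (FI.pow I 16)
  | none => none

/-- `e^q ∈ expFI q`. [folklore] -/
theorem mem_expFI {q : ℚ} {Y : FI} (h : expFI q = some Y) : FI.mem (Real.exp q) Y := by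
  unfold expFI at h
  split at h
  · rename_i I hI
    simp only [Option.some.injEq] at h
    subst h
    have hm := FI.mem_expSmall hI (FI.mem_ofRat (q / 16))
    have hp := FI.mem_pow hm 16
    rw [← Real.exp_nat_mul] at hp
    convert hp using 2
    push_cast
    ring
  · simp at h

/-- Enclosures of `cosh(q/2)` and `sinh(q/2)`. [folklore] -/
def coshSinhFI (q : ℚ) : Option (FI × FI) :=
  match expFI (q / 2), expFI (-(q / 2)) with
  | some P, some M => some ((P.add M).divNat 2, (P.sub M).divNat 2)
  | _, _ => none

/-- `cosh(q/2) ∈ (coshSinhFI q).1`, `sinh(q/2) ∈ (coshSinhFI q).2`. [folklore] -/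
theorem mem_coshSinhFI {q : ℚ} {CS : FI × FI} (h : coshSinhFI q = some CS) :
    FI.mem (Real.cosh ((q : ℝ) / 2)) CS.1 ∧ FI.mem (Real.sinh ((q : ℝ) / 2)) CS.2 := by
  unfold coshSinhFI at h
  split at h
  · rename_i P M hP hM
    simp only [Option.some.injEq] at h
    subst h
    have h1 := mem_expFI hP
    have h2 := mem_expFI hM
    push_cast at h1 h2
    constructor
    · have := FI.mem_divNat (FI.mem_add h1 h2) (n := 2) (by norm_num)
      rw [Real.cosh_eq]
      convert this using 1
      push_cast; ring_nf
    · have := FI.mem_divNat (FI.mem_sub h1 h2) (n := 2) (by norm_num)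
      rw [Real.sinh_eq]
      convert this using 1
      push_cast; ring_nf
  · simp at h

/-! ## Trigonometric values at the knots -/

/-- Powers of a complex box. [folklore] -/
def cbPow (W : CB) : ℕ → CB
  | 0 => CB.ofInt 1
  | n + 1 => CB.mul (cbPow W n) W

/-- `w^n ∈ cbPow W n`. [folklore] -/
theorem mem_cbPow {w : ℂ} {W : CB} (hw : CB.mem w W) : ∀ n : ℕ, CB.mem (w ^ n) (cbPow W n)
  | 0 => by simpa [cbPow] using CB.mem_ofInt 1
  | n + 1 => by rw [pow_succ]; exact CB.mem_mul (mem_cbPow hw n) hw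

/-- **Trigonometric values at the knots**: `e^{i (L + kh) u} ∈ Z₀ · W^k` for
`Z₀ ∋ e^{iLu}`, `W ∋ e^{ihu}`. [folklore] -/
theorem mem_knotTrig {L h u : ℚ} {Z0 W : CB} (hZ : CB.expI (FI.ofRat (L * u)) = some Z0)
    (hW : CB.expI (FI.ofRat (h * u)) = some W) (k : ℕ) :
    CB.mem (Complex.exp ((((L : ℝ) + k * h) * u : ℝ) * Complex.I)) (CB.mul Z0 (cbPow W k)) := by
  have h1 := CB.mem_expI hZ (FI.mem_ofRat (L * u))
  have h2 := CB.mem_expI hW (FI.mem_ofRat (h * u))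
  have h3 := mem_cbPow h2 k
  have e : Complex.exp ((((L : ℝ) + k * h) * u : ℝ) * Complex.I) =
      Complex.exp (((L * u : ℚ) : ℝ) * Complex.I) * Complex.exp (((h * u : ℚ) : ℝ) * Complex.I) ^ k := by
    rw [← Complex.exp_nat_mul, ← Complex.exp_add]
    congr 1
    push_cast
    ring
  rw [e]
  exact CB.mem_mul h1 h3

/-! ## The closed form `T` and `Ê_χ` at a rational point -/

/-- Enclosure of `T(x, u) = ((¼ − u²) cosh(x/2) cos(xu) + u sinh(x/2) sin(xu)) / (¼ + u²)²` from
enclosures of `cosh(x/2)`, `sinh(x/2)` and `e^{ixu}`. [folklore] -/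
def TFI (C S : FI) (Z : CB) (u : ℚ) : FI :=
  (((FI.ofRat (1 / 4 - u * u)).mul (C.mul Z.re)).add ((FI.ofRat u).mul (S.mul Z.im))).mul
    (FI.ofRat (1 / ((1 / 4 + u * u) ^ 2)))

/-- `T(x, u) ∈ TFI C S Z u`. [folklore] -/
theorem mem_TFI {x : ℝ} {u : ℚ} {C S : FI} {Z : CB} (hC : FI.mem (Real.cosh (x / 2)) C)
    (hS : FI.mem (Real.sinh (x / 2)) S) (hZ : CB.mem (Complex.exp (((x * u : ℝ)) * Complex.I)) Z) :
    FI.mem (pwT x u) (TFI C S Z u) := by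
  have hc : FI.mem (Real.cos (x * u)) Z.re := by
    have := hZ.1; rwa [Complex.exp_ofReal_mul_I_re] at this
  have hs : FI.mem (Real.sin (x * u)) Z.im := by
    have := hZ.2; rwa [Complex.exp_ofReal_mul_I_im] at this
  have hm := FI.mem_mul (FI.mem_add (FI.mem_mul (FI.mem_ofRat (1 / 4 - u * u)) (FI.mem_mul hC hc))
    (FI.mem_mul (FI.mem_ofRat u) (FI.mem_mul hS hs))) (FI.mem_ofRat (1 / ((1 / 4 + u * u) ^ 2)))
  unfold TFI pwT
  convert hm using 1
  push_cast
  have hD : (0 : ℝ) < 1 / 4 + (u : ℝ) * u := by nlinarith [mul_self_nonneg (u : ℝ)]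
  field_simp

/-- Interval sum over `Finset.Ico 1 K`. [folklore] -/
def fiSumIco (g : ℕ → FI) : ℕ → FI
  | 0 => FI.ofInt 0
  | 1 => FI.ofInt 0
  | K + 2 => (fiSumIco g (K + 1)).add (g (K + 1))

/-- `Σ_{k ∈ Ico 1 K} f k ∈ fiSumIco g K` if `f k ∈ g k` for `1 ≤ k < K`. [folklore] -/
theorem mem_fiSumIco {f : ℕ → ℝ} {g : ℕ → FI} :
    ∀ K : ℕ, (∀ k, 1 ≤ k → k < K → FI.mem (f k) (g k)) → FI.mem (∑ k ∈ Finset.Ico 1 K, f k) (fiSumIco g K)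
  | 0, _ => by simpa [fiSumIco] using FI.mem_ofInt 0
  | 1, _ => by simpa [fiSumIco] using FI.mem_ofInt 0
  | K + 2, h => by
    rw [Finset.sum_Ico_succ_top (by omega : 1 ≤ K + 1)]
    exact FI.mem_add (mem_fiSumIco (K + 1) fun k h1 h2 => h k h1 (by omega)) (h (K + 1) (by omega) (by omega))

/-- Enclosure of `ehatCF d u` from knot data `cs k ∋ (cosh(x_k/2), sinh(x_k/2))` and
`Z k ∋ e^{i x_k u}`. [folklore] -/
def ehatFI (d : PWKernel) (cs : ℕ → FI × FI) (Z : ℕ → CB) (u : ℚ) : FI :=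
  let T : ℕ → FI := fun k => TFI (cs k).1 (cs k).2 (Z k) u
  (FI.ofRat 4).mul ((((T 1).sub (T 0)).mul (FI.ofRat (1 / d.h))).add
    (fiSumIco (fun k => (FI.ofRat (d.chiAt k)).mul
      ((((T (k - 1)).sub ((FI.ofRat 2).mul (T k))).add (T (k + 1))).mul (FI.ofRat (1 / d.h)))) d.K))

/-- `ehatCF d u ∈ ehatFI d cs Z u`. [folklore] -/
theorem mem_ehatFI (d : PWKernel) {cs : ℕ → FI × FI} {Z : ℕ → CB} {u : ℚ}
    (hcs : ∀ k ≤ d.K, FI.mem (Real.cosh ((d.knot k : ℝ) / 2)) (cs k).1 ∧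
      FI.mem (Real.sinh ((d.knot k : ℝ) / 2)) (cs k).2)
    (hZ : ∀ k, CB.mem (Complex.exp ((((d.knot k : ℝ) * u : ℝ)) * Complex.I)) (Z k)) :
    FI.mem (d.ehatCF u) (ehatFI d cs Z u) := by
  have hT : ∀ k ≤ d.K, FI.mem (pwT (d.knot k) u) (TFI (cs k).1 (cs k).2 (Z k) u) :=
    fun k hk => mem_TFI (hcs k hk).1 (hcs k hk).2 (hZ k)
  have hK : 1 ≤ d.K := Nat.succ_le_of_lt (Nat.succ_pos _)
  unfold ehatFI PWKernel.ehatCF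
  refine FI.mem_mul (by exact_mod_cast FI.mem_ofRat 4) (FI.mem_add ?_ (mem_fiSumIco d.K (fun k h1 h2 => ?_)))
  · have := FI.mem_mul (FI.mem_sub (hT 1 hK) (hT 0 (Nat.zero_le _))) (FI.mem_ofRat (1 / d.h))
    convert this using 1; push_cast; ring
  · have := FI.mem_mul (FI.mem_ofRat (d.chiAt k)) (FI.mem_mul (FI.mem_add (FI.mem_sub (hT (k - 1) (by omega))
      (FI.mem_mul (FI.mem_ofRat 2) (hT k h2.le))) (hT (k + 1) h2)) (FI.mem_ofRat (1 / d.h)))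
    convert this using 1; push_cast; ring

/-! ## The comb `Σ_n a_n cos(u log n)` over a list of nodes -/

/-- Enclosure of `Σ_{n ∈ l} a(n) cos(u log n)` (logarithms from the engine's table of size `N`). [folklore] -/
def combFI (l : List ℕ) (a : ℕ → ℚ) (N : ℕ) (u : ℚ) : FI :=
  l.foldr (fun n acc => ((FI.ofRat (a n)).mul (FI.cosSin ((FI.ofRat u).mul ((FI.logTable N).getD n (FI.ofInt 0)))).1).add acc)
    (FI.ofInt 0)

/-- `Σ_{n ∈ l} a(n) cos(u log n) ∈ combFI l a N u` when all `n ≤ N` and the table checks. [folklore] -/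
theorem mem_combFI {l : List ℕ} {a : ℕ → ℚ} {N : ℕ} (hok : FI.logTableOK N = true)
    (hl : ∀ n ∈ l, n ≤ N) (u : ℚ) :
    FI.mem (l.map (fun n => (a n : ℝ) * Real.cos ((u : ℝ) * Real.log n))).sum (combFI l a N u) := by
  induction l with
  | nil => simpa [combFI] using FI.mem_ofInt 0
  | cons n t ih =>
    have hn : n ≤ N := hl n (by simp)
    have ht : ∀ m ∈ t, m ≤ N := fun m hm => hl m (by simp [hm])
    rw [List.map_cons, List.sum_cons]
    show FI.mem _ (((FI.ofRat (a n)).mul (FI.cosSin ((FI.ofRat u).mul ((FI.logTable N).getD n (FI.ofInt 0)))).1).add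
      (combFI t a N u))
    refine FI.mem_add ?_ (ih ht)
    have hθ := FI.mem_mul (FI.mem_ofRat u) (FI.mem_logTable hok hn)
    exact FI.mem_mul (FI.mem_ofRat (a n)) (FI.mem_cosSin hθ).1

end PW

end Summit.RiemannHypothesis.RiemannHypothesis.Theorems.SignCone

end
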